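import Summits.CriticalPhenomena.SAWScalingLimit.Theorems.FKGToTraversalBound.Negative.R1Split

/-!
# Crux `FKGToTraversalBound` (stmt-CriticalPhenomena-1878) — the residue stub of every line is non-vacuous AT EVERY SMALL MESH

Negative-side helper for the line leads' terminal audit (lead c3, 2026-08-16; `Cruxes/FKGToTraversalBound/Lines/*-dead.md`).
Every planned line of this crux composes `LeftRightFKG → SAWTraversalBound` through an engine that only ever sees
PRESENTABLE lattice domains — `(D_δ, a_δ, b_δ)` whose graph `discreteDomainGraph D.carrier δ` coincides with the graph of an
r2 carrier `dom C δ = {z | wind(C, z) ≠ 0}` of a closed lattice walk `C` with BOTH endpoints lattice-adjacent to vertices of `C`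
(the binders of `LeftRightFKG`) — and carries a residue stub for the meshes where this fails
(`stub_residualShells` ≡ `stub_deepEndpoints` ≡ `stub_classExtension` ≡ `stub_untameFragment` ≡ `stub_deepEndpointReduction`).

`Negative/R1Split.lean` certifies that the R1 class (`BdryApprox`, an EVENTUAL statement) omits an admissible approximation.
This file certifies the PER-MESH statement the residue stubs actually quantify over: for the depth-`√δ` approximation of the
unit disc (`TPToTraversalBound.Negative.exists_isEndpointApprox_deepStart`) the lattice domain is NOT presentable at ANY mesh
`δ ≤ 1/16` at which the start lies in `Ω_δ` (`deepStart_not_presentable`), in particular at every small mesh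
(`deepStart_eventually_not_presentable`, using only `IsEndpointApprox`).  Mechanism (`not_presentable_of_ball_subset`): a
presenting walk `C` would pass through a lattice neighbour `u'` of the start; `u'` lies in the `√δ`-ball, hence is joined to
the start by an edge of `Ω_δ`; transporting that edge along the graph equality makes `u'` a site of `dom C δ`, but vertices of
`C` lie on the trace, where `wind` is the junk `0` (`notMem_dom_of_mem_support`).  Consequently no `δ₀` makes the residue
stub vacuous for this approximation: per-shell tightness of the critical SAW from a deep start is genuinely demanded, and no
instance of `LeftRightFKG` speaks about it (`not_presentable_of_enclosed`, `noFloatingHoles`,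
`LeftRightFKG.Negative.leftRightFKG_false_without_boundaryAdjacency`).
-/

noncomputable section

namespace Summit.CriticalPhenomena.SAWScalingLimit.Theorems.FKGToTraversalBound.Negative

open Literature.Probability.RandomPlanarGeometry Literature.Probability.LatticeModels
open Filter Topology Set Metric

/-- **No r2 presentation near a deep site.**  If the `√δ`-ball about the mesh point of a site `x ∈ Ω_δ` lies inside `Ω`
(`0 < δ < 1`), then no closed lattice walk `C` through a lattice neighbour `u'` of `x` presents the lattice domain:
`discreteDomainGraph Ω δ ≠ discreteDomainGraph (dom C δ) δ`.  (The edge `x ∼ u'` of `Ω_δ` would make `u' ∈ C.support` a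
site of `dom C δ`, contradicting `notMem_dom_of_mem_support`.) [folklore] -/
theorem not_presentable_of_ball_subset {Ω : Set ℂ} {δ : ℝ} (hδ : 0 < δ) (hδ1 : δ < 1) {x : Site 2}
    (hball : Metric.ball (meshPoint δ x) (Real.sqrt δ) ⊆ Ω) (hx : x ∈ meshDomain Ω δ)
    {c u' : Site 2} (C : (zdGraph 2).Walk c c) (hu' : u' ∈ C.support) (hxu' : (zdGraph 2).Adj x u') :
    discreteDomainGraph Ω δ ≠ discreteDomainGraph (dom C δ) δ := by
  intro hG
  have hδs : δ < Real.sqrt δ := by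
    rw [Real.lt_sqrt hδ.le]
    nlinarith
  have hyball : meshPoint δ u' ∈ Metric.ball (meshPoint δ x) (Real.sqrt δ) := by
    rw [Metric.mem_ball, dist_eq_norm]
    calc ‖meshPoint δ u' - meshPoint δ x‖
        ≤ |(meshPoint δ u' - meshPoint δ x).re| + |(meshPoint δ u' - meshPoint δ x).im| :=
          Complex.norm_le_abs_re_add_abs_im _
      _ = δ := (abs_re_im_meshPoint_sub_of_adj hδ.le hxu').2.2
      _ < Real.sqrt δ := hδs
  have hxball : meshPoint δ x ∈ Metric.ball (meshPoint δ x) (Real.sqrt δ) :=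
    Metric.mem_ball_self (Real.sqrt_pos.2 hδ)
  have hseg : segment ℝ (meshPoint δ x) (meshPoint δ u') ⊆ closure Ω :=
    ((convex_ball _ _).segment_subset hxball hyball).trans (hball.trans subset_closure)
  have hmadj : (meshGraph Ω δ).Adj x u' := meshGraph_adj_iff.2 ⟨hxu', hseg⟩
  have hu'V : u' ∈ meshVertices Ω δ := hball hyball
  have hadj : (discreteDomainGraph Ω δ).Adj x u' :=
    discreteDomainGraph_adj_iff.2 ⟨hmadj, hx, mem_meshDomain_of_adj hx hu'V hmadj⟩
  rw [hG] at hadj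
  have hu'D : u' ∈ meshDomain (dom C δ) δ := (discreteDomainGraph_adj_iff.1 hadj).2.2
  exact notMem_dom_of_mem_support C δ hu' (meshDomain_subset_meshVertices _ _ hu'D)

/-- **The residue is non-vacuous at every small mesh (per-δ form).**  For the depth-`√δ` endpoint approximation of the unit
disc there is NO presentation `(C, u', v')` — `u', v' ∈ C.support`, `a δ ∼ u'`, `b δ ∼ v'`,
`discreteDomainGraph 𝔻 δ = discreteDomainGraph (dom C δ) δ` (verbatim the body of the line skeletons' `Presentable`) — at any
mesh `0 < δ ≤ 1/16` at which the start is a site of `Ω_δ` (exactly where the SAW law is not junk). [folklore] -/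
theorem deepStart_not_presentable :
    ∃ a b : ℝ → Site 2, SAW.IsEndpointApprox DobrushinDomain.unitDisc a b ∧
      ∀ δ : ℝ, 0 < δ → δ ≤ 1 / 16 → a δ ∈ meshDomain DobrushinDomain.unitDisc.carrier δ →
        ¬ ∃ (c u' v' : Site 2) (C : (zdGraph 2).Walk c c), u' ∈ C.support ∧ v' ∈ C.support ∧
            (zdGraph 2).Adj (a δ) u' ∧ (zdGraph 2).Adj (b δ) v' ∧
            discreteDomainGraph DobrushinDomain.unitDisc.carrier δ = discreteDomainGraph (dom C δ) δ := by
  obtain ⟨a, b, hab, hdeep⟩ := TPToTraversalBound.Negative.exists_isEndpointApprox_deepStart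
  refine ⟨a, b, hab, fun δ hδ hδ16 haD => ?_⟩
  rintro ⟨c, u', v', C, hu', -, hau', -, hG⟩
  exact not_presentable_of_ball_subset hδ (by linarith) (hdeep δ hδ hδ16) haD C hu' hau' hG

/-- Along an endpoint approximation the start is eventually a site of `Ω_δ` (the two legs tend to the two DISTINCT marked
points, so they are eventually distinct, and a joining walk of positive length starts with an edge of `Ω_δ`). [folklore] -/
theorem eventually_start_mem_meshDomain {D : DobrushinDomain} {a b : ℝ → Site 2} (hab : SAW.IsEndpointApprox D a b) :
    ∀ᶠ δ in 𝓝[>] (0 : ℝ), a δ ∈ meshDomain D.carrier δ := by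
  have hpq : D.pt 0 ≠ D.pt 1 := fun h => absurd (D.pt_injective h) (by decide)
  have hr : 0 < dist (D.pt 0) (D.pt 1) / 2 := by
    have := dist_pos.2 hpq
    positivity
  filter_upwards [(Metric.tendsto_nhds.1 hab.tendsto_fst) _ hr, (Metric.tendsto_nhds.1 hab.tendsto_snd) _ hr,
    hab.reachable] with δ hδa hδb hreach
  have hne : a δ ≠ b δ := by
    intro heq
    rw [heq] at hδa
    have h3 := dist_triangle (D.pt 0) (meshPoint δ (b δ)) (D.pt 1)
    rw [dist_comm] at hδa
    linarith
  have key : ∀ (x y : Site 2) (q : (discreteDomainGraph D.carrier δ).Walk x y), x ≠ y →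
      x ∈ meshDomain D.carrier δ := by
    intro x y q hxy
    cases q with
    | nil => exact absurd rfl hxy
    | cons hadj _ => exact (discreteDomainGraph_adj_iff.1 hadj).2.1
  obtain ⟨p⟩ := hreach
  exact key _ _ p hne

/-- **The residue is non-vacuous at every small mesh (eventual form, hypothesis-free).**  For the depth-`√δ` approximation of
the unit disc, `(𝔻_δ, a δ, b δ)` is not presentable for ALL sufficiently small `δ > 0`: no choice of `δ₀` in a residue stub
(`ShellTightOn (¬ Presentable …)`, `UntameTraversalBound`, `PerShellTightnessBdry → PerShellTightness`,
`TameTraversalBound → SAWTraversalBound`, `DeepEndpointReduction`) can avoid this approximation. [folklore] -/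
theorem deepStart_eventually_not_presentable :
    ∃ a b : ℝ → Site 2, SAW.IsEndpointApprox DobrushinDomain.unitDisc a b ∧
      ∀ᶠ δ in 𝓝[>] (0 : ℝ),
        ¬ ∃ (c u' v' : Site 2) (C : (zdGraph 2).Walk c c), u' ∈ C.support ∧ v' ∈ C.support ∧
            (zdGraph 2).Adj (a δ) u' ∧ (zdGraph 2).Adj (b δ) v' ∧
            discreteDomainGraph DobrushinDomain.unitDisc.carrier δ = discreteDomainGraph (dom C δ) δ := by
  obtain ⟨a, b, hab, h⟩ := deepStart_not_presentable
  refine ⟨a, b, hab, ?_⟩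
  have hsmall : Set.Ioc (0 : ℝ) (1 / 16) ∈ 𝓝[>] (0 : ℝ) := Ioc_mem_nhdsGT (by norm_num)
  filter_upwards [hsmall, eventually_start_mem_meshDomain hab] with δ hδ haD
  exact h δ hδ.1 hδ.2 haD

end Summit.CriticalPhenomena.SAWScalingLimit.Theorems.FKGToTraversalBound.Negative

end
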